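import Summits.ABC.IUTFork.Cor312HullStableDHVol
import Summits.ABC.IUTFork.Cor312HullGluedDHVol
import HarnessLib

/-!
# [IUTchIII] Cor. 3.12 — the hull-glued setting at the SHARP setting of record: unchanged local Θ-volume at EVERY odd
# prime `p ∤ disc(F)`, arbitrary Θ-ideles; the exceptional packets lie over `2·disc(F)` only

PROOF-ONLY composition piece of the abc-iut cell (Cor. 3.12 sub-crew, seat abc-iut-c312-5, gen 4); TAKES NO SIDE on
[IUTchIII] Cor. 3.12; no definition, no `Prop` fact. abc-iut-w5-d060's `Cor312HullGluedStable` (p424693) derives the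
hull-gluing bracket — `P♮ := P.hullGlued`, print's `^{n,∘}𝒰_{j,v_ℚ}` (kurims `paper:url-4b091feeb646` p. 174 l. 50 –
p. 175 l. 1) as THE Θ-region at every packet, has the same packet hulls and local Θ-volumes — packet by packet from
ONE-SET STABILITY `hst` of `^{n,∘}𝒰_{j,v_ℚ}`; their `Cor312HullGluedDHVol` (p425664) discharged `hst` at the sharp setting
of record (`Real.settingDHVolSharp`, abc-iut-c312-3 p419746) at the odd `p ∤ disc(F)` where the Θ-ideles are UNITS, and
bounded the exceptional packets by the primes under `S` or over `2·disc(F)`. With gen 4's `Cor312HullStableDHVol` (`hst`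
at EVERY odd `p ∤ disc(F)` for ARBITRARY non-zero Θ-ideles) this file records, for every label `i+1 ∈ 𝔽_l^⋇`:

* `hullGlued_possibleImages_settingDHVolSharp_of_unramified` — at `(i+1, p)`, `p` odd `∤ disc(F)`: the possible images
  of `P♮` are `{^{n,∘}𝒰_{i+1,p}}` and the packet hull of `P♮` IS `^{n,∘}𝒰_{i+1,p}`;
* **`hullGlued_thetaLocal_settingDHVolSharp_of_unramified`** — there `P♮` has `HullDefined` and the SAME local Θ-volume;
* **`hullGlued_thetaLocal_ne_subset_dvd`** / `finite_hullGlued_thetaLocal_ne_settingDHVolSharp'` — the packets `(i+1, p)`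
  where the hull-gluing changes the local Θ-volume lie over the primes dividing `2·disc(F)` (finitely many), with NO
  hypothesis on where the Θ-ideles are units (p425664 needed them units off `S`).
So at the setting ADJUDICATION-SPEC §1 names, the trade «(Ind3)-family ↦ print's hull» is harmless at every packet over
an odd unramified prime BY THEOREM; what remains of the bracket sits over `2·disc(F)`, where the seat's negative finding
(typed (Ind2) at a ramified place moves hull-sets, `Cor312Ind2BallsRamified`; hull inflation by `p⁻¹`, hand computation
on HOME/STATUS) says `hst` can genuinely fail. [claim: Mochizuki2012, status: disputed] vocabulary only;
[cite: DupuyHilado2025, §3.9, §4.7, §4.9].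
-/

noncomputable section

open Set Function NumberField IsDedekindDomain

namespace Summit.ABC

namespace IUTFork

namespace Thm311

namespace Real

open Cor312 Cor312Vol Literature.IUT.LogThetaLattice Literature.IUT.LogVolume

variable {F : Type} [Field F] [NumberField F] (X : PilotData F) {logv : PadicLogs F} (hlog : LogvAnalytic logv)

variable (t : ∀ (pp : Nat.Primes) (_ : Fin X.lstar) (x : (thetaIndex X).Fibre (.inr pp)),
    haveI : Fact (pp : ℕ).Prime := ⟨pp.2⟩; kOf X pp.1 x)
  (tq : ∀ (pp : Nat.Primes) (x : (thetaIndex X).Fibre (.inr pp)),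
    haveI : Fact (pp : ℕ).Prime := ⟨pp.2⟩; kOf X pp.1 x)
  (M : Type) [Field M] [NumberField M]
  (archPk : ∀ (j : (thetaIndex X).Label) (vQ : (thetaIndex X).VQ), Set ((logShellsDH X logv).Packet j vQ))
  (archSub : ∀ (j : (thetaIndex X).Label) (v : (thetaIndex X).V),
    Set ((logShellsDH X logv).Packet j ((thetaIndex X).over v)))
  (Ψ : ℤ → ∀ v : (thetaIndex X).V, v ∈ (thetaIndex X).Vbad → Set ((logShellsDH X logv).StarPacket v))
  (act : ℤ → ∀ v : (thetaIndex X).V, v ∈ (thetaIndex X).Vbad →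
    (logShellsDH X logv).StarPacket v → Module.End ℚ ((logShellsDH X logv).StarPacket v))
  (Mmod : ℤ → ∀ j : (thetaIndex X).LabelStar, Set ((logShellsDH X logv).GlobalPacket j.1))
  (region : ℤ → ∀ j : (thetaIndex X).LabelStar, FinDivisor M → ∀ vQ : (thetaIndex X).VQ,
    Set ((logShellsDH X logv).Packet j.1 vQ))
  (n : ℤ) {HT : Type} {LogLink : HT → HT → Type} {IsFull : ∀ {s t : HT}, LogLink s t → Prop}
  (lat : LGPGaussianLogThetaLattice LogLink IsFull)
  {Frd : Type} {IsoF : Frd → Frd → Type} {Ob : Frd → Type} {realify : Frd → Frd} {Strip : Type}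
  {IsoS : Strip → Strip → Type} {Mv : ∀ v : (thetaIndex X).V, v ∈ (thetaIndex X).Vbad → Type}
  [∀ v h, Monoid (Mv v h)]
  (sig : GlobalLGPFrobenioidSignature (thetaIndex X).lstar (thetaIndex X).V (· ∈ (thetaIndex X).Vbad)
    Frd IsoF Ob realify Strip IsoS Mv)
  (split : SplittingMonoids Mv) {ObΔ : Type} {N : ∀ v : (thetaIndex X).V, v ∈ (thetaIndex X).Vbad → Type}
  [∀ v h, Monoid (N v h)] (qData : QPilotData ObΔ N)

/-- **At an odd `p ∤ disc(F)` the possible images of the hull-glued sharp setting at `(i+1, p)` are `{^{n,∘}𝒰_{i+1,p}}`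
and its packet hull IS `^{n,∘}𝒰_{i+1,p}`** — arbitrary non-zero Θ-ideles. [claim: Mochizuki2012, status: disputed] -/
theorem hullGlued_possibleImages_settingDHVolSharp_of_unramified (ht0 : ∀ pp i x, t pp i x ≠ 0)
    (htq0 : ∀ pp x, tq pp x ≠ 0)
    (htq1 : ∀ (pp : Nat.Primes) (x : (thetaIndex X).Fibre (.inr pp)),
      haveI : Fact (pp : ℕ).Prime := ⟨pp.2⟩; placeOf X pp.1 x ∉ X.S → ‖tq pp x‖ = 1)
    (i : Fin (thetaIndex X).lstar) (pp : Nat.Primes) (hp2 : 2 < (pp : ℕ))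
    (hdisc : ¬ ((pp : ℕ) : ℤ) ∣ NumberField.discr F) :
    (settingDHVolSharp X hlog M archPk archSub Ψ act Mmod region n lat sig split qData tq t htq0
        htq1).hullGlued.possibleImages (Setting.labelSucc i) (.inr pp) =
      {(settingDHVolSharp X hlog M archPk archSub Ψ act Mmod region n lat sig split qData tq t htq0
        htq1).thetaHull (Setting.labelSucc i) (.inr pp)} ∧
    (settingDHVolSharp X hlog M archPk archSub Ψ act Mmod region n lat sig split qData tq t htq0
        htq1).hullGlued.thetaHull (Setting.labelSucc i) (.inr pp) =
      (settingDHVolSharp X hlog M archPk archSub Ψ act Mmod region n lat sig split qData tq t htq0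
        htq1).thetaHull (Setting.labelSucc i) (.inr pp) :=
  (settingDHVolSharp X hlog M archPk archSub Ψ act Mmod region n lat sig split qData tq t htq0
      htq1).hullGlued_possibleImages_thetaHull_of_stable
    (stable_thetaHull_settingDHVolSharp_of_unramified X hlog t tq M archPk archSub Ψ act Mmod region n lat sig split
      qData ht0 htq0 htq1 i pp hp2 hdisc)

/-- **At an odd `p ∤ disc(F)` the hull-gluing changes nothing at `(i+1, p)` of the sharp setting of record**: `HullDefined`
for `P♮` and the SAME local Θ-volume — for ARBITRARY non-zero Θ-ideles (p425664 `hullGlued_thetaLocal_settingDHVolSharp_of_good`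
needed them units at `p`). [claim: Mochizuki2012, status: disputed] -/
theorem hullGlued_thetaLocal_settingDHVolSharp_of_unramified (ht0 : ∀ pp i x, t pp i x ≠ 0)
    (htq0 : ∀ pp x, tq pp x ≠ 0)
    (htq1 : ∀ (pp : Nat.Primes) (x : (thetaIndex X).Fibre (.inr pp)),
      haveI : Fact (pp : ℕ).Prime := ⟨pp.2⟩; placeOf X pp.1 x ∉ X.S → ‖tq pp x‖ = 1)
    (i : Fin (thetaIndex X).lstar) (pp : Nat.Primes) (hp2 : 2 < (pp : ℕ))
    (hdisc : ¬ ((pp : ℕ) : ℤ) ∣ NumberField.discr F) :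
    (settingDHVolSharp X hlog M archPk archSub Ψ act Mmod region n lat sig split qData tq t htq0
        htq1).hullGlued.HullDefined (Setting.labelSucc i) (.inr pp) ∧
      (settingDHVolSharp X hlog M archPk archSub Ψ act Mmod region n lat sig split qData tq t htq0
          htq1).hullGlued.thetaLocal (Setting.labelSucc i) (.inr pp) =
        (settingDHVolSharp X hlog M archPk archSub Ψ act Mmod region n lat sig split qData tq t htq0
          htq1).thetaLocal (Setting.labelSucc i) (.inr pp) :=
  (settingDHVolSharp X hlog M archPk archSub Ψ act Mmod region n lat sig split qData tq t htq0
      htq1).hullGlued_hullDefined_thetaLocal_of_stable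
    (stable_thetaHull_settingDHVolSharp_of_unramified X hlog t tq M archPk archSub Ψ act Mmod region n lat sig split
      qData ht0 htq0 htq1 i pp hp2 hdisc)
    (frameHyps_settingDHVol X hlog M archPk archSub Ψ act Mmod region n lat sig split qData _ _ _ _ i (.inr pp)).1
    (hullDefined_settingDHVolSharp_of_unramified X hlog t tq M archPk archSub Ψ act Mmod region n lat sig split qData
      ht0 htq0 htq1 i pp hdisc)

/-- **The packets `(i+1, p)` where the hull-gluing changes the local Θ-volume of the sharp setting of record lie over
the primes dividing `2·disc(F)`** — no hypothesis on where the Θ-ideles are units. [claim: Mochizuki2012, status: disputed] -/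
theorem hullGlued_thetaLocal_ne_subset_dvd (ht0 : ∀ pp i x, t pp i x ≠ 0) (htq0 : ∀ pp x, tq pp x ≠ 0)
    (htq1 : ∀ (pp : Nat.Primes) (x : (thetaIndex X).Fibre (.inr pp)),
      haveI : Fact (pp : ℕ).Prime := ⟨pp.2⟩; placeOf X pp.1 x ∉ X.S → ‖tq pp x‖ = 1)
    (i : Fin (thetaIndex X).lstar) :
    {pp : Nat.Primes |
      (settingDHVolSharp X hlog M archPk archSub Ψ act Mmod region n lat sig split qData tq t htq0
          htq1).hullGlued.thetaLocal (Setting.labelSucc i) (.inr pp) ≠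
        (settingDHVolSharp X hlog M archPk archSub Ψ act Mmod region n lat sig split qData tq t htq0
          htq1).thetaLocal (Setting.labelSucc i) (.inr pp)} ⊆
      {pp : Nat.Primes | (pp : ℕ) ∣ 2 * (NumberField.discr F).natAbs} := by
  intro pp hpp
  by_contra hgood
  obtain ⟨hp2, hdisc⟩ := good_of_not_dvd (F := F) pp hgood
  exact hpp (hullGlued_thetaLocal_settingDHVolSharp_of_unramified X hlog t tq M archPk archSub Ψ act Mmod region n lat
    sig split qData ht0 htq0 htq1 i pp hp2 hdisc).2

/-- … hence they are FINITELY MANY, for arbitrary non-zero Θ-ideles (p425664's `finite_hullGlued_thetaLocal_ne_settingDHVolSharp`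
without its hypothesis `ht1`). [claim: Mochizuki2012, status: disputed] -/
theorem finite_hullGlued_thetaLocal_ne_settingDHVolSharp' (ht0 : ∀ pp i x, t pp i x ≠ 0) (htq0 : ∀ pp x, tq pp x ≠ 0)
    (htq1 : ∀ (pp : Nat.Primes) (x : (thetaIndex X).Fibre (.inr pp)),
      haveI : Fact (pp : ℕ).Prime := ⟨pp.2⟩; placeOf X pp.1 x ∉ X.S → ‖tq pp x‖ = 1)
    (i : Fin (thetaIndex X).lstar) :
    {pp : Nat.Primes |
      (settingDHVolSharp X hlog M archPk archSub Ψ act Mmod region n lat sig split qData tq t htq0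
          htq1).hullGlued.thetaLocal (Setting.labelSucc i) (.inr pp) ≠
        (settingDHVolSharp X hlog M archPk archSub Ψ act Mmod region n lat sig split qData tq t htq0
          htq1).thetaLocal (Setting.labelSucc i) (.inr pp)}.Finite :=
  (finite_primes_dvd (mul_ne_zero two_ne_zero (Int.natAbs_ne_zero.2 (NumberField.discr_ne_zero F)))).subset
    (hullGlued_thetaLocal_ne_subset_dvd X hlog t tq M archPk archSub Ψ act Mmod region n lat sig split qData ht0 htq0
      htq1 i)

end Real

end Thm311

end IUTFork

end Summit.ABC

end
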